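/-
Copyright (c) 2026 the pub-hodgecm-mathlib formalisation cell (harness21).  Prover seat hodgecm-mathlib-F0P3a-p08 (g20): road «S3-ram» (LEAD F0P3a-plan (g13);
owner F0P3a-p06 (g15)), (T2) G-side organ (Cnt2′) (chair F0P3a-p07 (g14) RULINGS (9)(b)∕(10)(3)), organ (z6) «FIX-FINITE, BLOCK LITERAL», part (z6-d)
«TUBE BOUND + J₀ DRESS»; 2026-09-02.
-/
import Literature.NumberTheory.Automorphic.UnitaryLatticeTreeBlockFixedFinite       -- ★ p848592 (this seat): THM A∕B `finite_setOf_selfDual_mapGL_endoGL_eq`, `finite_setOf_latticeGraphIso_endoGL_eq`; brings ★ TubeCoordinate (`exists_tubeCoordinate`, `exists_smul_add_of_tubeCoordinate`), ★ AxisEndoFrame (`isIntMatrix_coe_endoGL_iff`)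
import Literature.NumberTheory.Automorphic.UnitaryLatticeTreeFramesOfInvolution      -- ★ (B-p14∕F0P3a-p07): `isTree_latticeGraph_three_of_neg`; brings ★ `finite_neighborSet_of_ramified`, ★ `UnitaryGroup.mem_unitaryInt_iff_forall_v_apply_le_one`
import Literature.NumberTheory.Automorphic.UnitaryLatticeTreeStarOfInvolution        -- ★ (F0P3a-p07): `isSelfDualLattice_iff_not_isSelfDualLattice_of_adj_of_v` (alternation)
import HarnessLib

/-!
# The lattice graph of a hermitian space — THE TUBE BOUND `|χ_{γ₂}(u)| ≤ |ϖ|^{2b}` for a fixed self-dual lattice of a block element, and the fixed set of `ι(γ₂, u)` in the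
# `Φ₃`-model is finite (Bruhat–Tits 1972 §10; Kottwitz 1986 §3; Serre, *Trees* II.1.1)

Topic `NumberTheory/Automorphic`; namespace `Literature.NumberTheory.Automorphic.UnitaryLatticeTree`.  THEOREMS ONLY (no definition, no instance, no notation, no named fact,
no `sorry`); kernel lane `--supports stmt-HodgeConjecture-24833`; datum-free (`K` with `Valued K ℤᵐ⁰`; `[IsPrincipalIdealRing 𝒪[K]]` for the axis-vertex basis, discharged
downstream by ★ `isPrincipalIdealRing_integer_adicCompletion`).  Cell `pub/hodgecm-mathlib` (D-0151), crux H413; road «S3-ram» (Literature seeding, count-neutral); (T2) G-side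
organ (Cnt2′) (chair F0P3a-p07 (g14)), organ **(z6) «FIX-FINITE, BLOCK LITERAL»**, part **(z6-d) «TUBE BOUND + J₀ DRESS»**: the two sockets `R`, `htube` of ★ THM A∕B
(`UnitaryLatticeTreeBlockFixedFinite`, p848592) are discharged by `det(γ₂ − u₀₀·1) ≠ 0`, and THM B is dressed in the `Φ₃ = antidiag(1,1,1)`-model of the route-B head
`strataCount_J₀_block` (F0P2-p02 (g14)) — its `hFfin` binder verbatim at a type-(2) literal `γ` with matrix `ι(γ₂, u)`.

THE MATHEMATICS.  BLOCK CURRENCY (`V = W ⊕ Ke₁`, `H = !![H₂ 0 0, 0, H₂ 0 1; 0, h, 0; H₂ 1 0, 0, H₂ 1 1]`, `Γ = ι(γ₂, u) = endoGL (γ₂, u)`, `pr_W x = x − x₁e₁`).  Put `S := Γ − u₀₀·1`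
and `T₂ := γ₂ − u₀₀·1` (so `det T₂ = χ_{γ₂}(u₀₀)`).  `S` kills `e₁`, preserves `W` and acts there by `T₂`, whence the CAYLEY–HAMILTON identity
`det T₂ · pr_W x = tr T₂ · Sx − S(Sx)` (§1).  If `M` is a lattice with `Γ·M ≤ M` and tube coordinate `b` (`c·e₁ ∈ M ⟺ |c| ≤ |ϖ|^b`), then `|u₀₀| ≤ 1` (`Γ(ϖ^b e₁) = u₀₀ϖ^b e₁ ∈ M`),
so `S·M ≤ M`, and with `|tr T₂| ≤ 1` we get **`det T₂ · pr_W M ≤ M`**.  For `M` SELF-DUAL with `b ≥ 1` the glue module `pr_W M ∕ (M ∩ W)` is cyclic of length `2b`, generated by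
`pr_W x₀` for a generator `x₀` (★ (c1-ii′) `exists_smul_add_of_tubeCoordinate`: `c·pr_W x₀ ∈ M ⟺ |c| ≤ |ϖ|^{2b}`), hence the **TUBE BOUND `|det T₂| ≤ |ϖ|^{2b}`**, i.e.
`b ≤ v(χ_{γ₂}(u₀₀))∕2`.  So when `χ_{γ₂}(u₀₀) ≠ 0` (at the CM place: `χ_{γ₂}` has no root in `K`) the tube bound `R := v(χ_{γ₂}(u₀₀))` of ★ THM A∕B holds, and the fixed
self-dual lattices ∕ the fixed vertex set of `Γ` are FINITE given finitely many `γ₂`-fixed self-dual `W`-lattices (§2).  §3 specialises to `H = Φ₃ = ι-shape(Φ₂, 1)`,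
`Φ₂ = !![0,1;1,0]`, where the tree, the alternation of vertex types and the finiteness of stars are ★ (`isTree_latticeGraph_three_of_neg`, `isSelfDualLattice_iff_not_…_of_adj_of_v`,
`finite_neighborSet_of_ramified`) under the tame-ramified hypotheses `(hσ hvσ hσϖ hϖ hres h2 hnorm)` of `strataCount_J₀_block`, and `|tr T₂| ≤ 1` follows from `γ ∈ K₀ = unitaryInt`.

* §1 `endoGL_sub_smul_one_mulVec_mem`, `det_sub_smul_one_smul_sub_single_eq` (Cayley–Hamilton), `v_coe_one_le_one_of_tubeCoordinate` (`|u₀₀| ≤ 1`),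
  `det_sub_smul_one_smul_sub_single_mem` (`det T₂ · pr_W x ∈ M`), **`v_det_sub_smul_one_le_of_tubeCoordinate`** (TUBE BOUND), `tubeCoordinate_le_of_v_det_eq` (`b ≤ R`).
* §2 **`finite_setOf_selfDual_mapGL_endoGL_eq_of_det_ne_zero`** (THM A′), **`finite_setOf_latticeGraphIso_endoGL_eq_of_det_ne_zero`** (THM B′).
* §3 `antidiagonal_three_over_eq_endoShape`, `eval_charpoly_fin_two_eq_det_sub_smul_one`, **`finite_setOf_latticeGraphIso_antidiagonal_three_eq_of_coe_eq_endoGL`** (J₀ DRESS,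
  `hΔ` currency), **`finite_setOf_latticeGraphIso_antidiagonal_three_eq_of_not_isRoot_charpoly`** (`hirr` currency).

HONEST LABEL: HC_CM is proved only modulo the 2 remaining named inputs (hLiu418 24832, h413 24833) until rung 0 closes; nothing printed is asserted here (elementary lattice
bookkeeping); «S3-ram» has no books consequence.

## References
* [BruhatTits1972] F. Bruhat, J. Tits, *Groupes réductifs sur un corps local I*, Publ. Math. IHÉS 41 (1972), §10 (lattice models; bounded fixed sets of elliptic elements).
* [Kottwitz1986] R. E. Kottwitz, *Base change for unit elements of Hecke algebras*, Compositio Math. 60 (1986), §3 (finiteness of the fixed lattice set of an elliptic element).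
* [Serre1980Trees] J.-P. Serre, *Trees* (1980), Ch. I §6.4 (fixed points), Ch. II §1.1 (lattices, distance), §1.3 (elements with bounded fixed sets).
* [Rogawski1990] J. D. Rogawski, *Automorphic Representations of Unitary Groups in Three Variables*, Ann. of Math. Stud. 123 (1990), §4.8 Case (a) p. 53, §4.9 pp. 54–56.
-/

set_option autoImplicit false

noncomputable section

open scoped Valued WithZero Matrix MatrixGroups

namespace Literature.NumberTheory.Automorphic.UnitaryLatticeTree

open Literature.NumberTheory.Automorphic Literature.NumberTheory.Automorphic.HermitianLattice Literature.NumberTheory.Rogawski1990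

variable {K : Type*} [Field K] [Valued K ℤᵐ⁰]

/-! ## §1 The Cayley–Hamilton identity of `S = Γ − u₀₀·1` and the TUBE BOUND -/

/-- `S·x ∈ M` for `x ∈ M`, `S = Γ − u₀₀·1`, when `Γ·M ≤ M` and `|u₀₀| ≤ 1`. [cite: Kottwitz1986, §3] [cite: BruhatTits1972, §10] -/
theorem endoGL_sub_smul_one_mulVec_mem {M : Submodule 𝒪[K] (Fin 3 → K)} (γ₂ : GL (Fin 2) K) (u : GL (Fin 1) K)
    (hu : Valued.v ((u : Matrix (Fin 1) (Fin 1) K) 0 0) ≤ 1) (hfix : mapGL (endoGL (γ₂, u)) M ≤ M) {x : Fin 3 → K} (hx : x ∈ M) :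
    (((endoGL (γ₂, u) : GL (Fin 3) K) : Matrix (Fin 3) (Fin 3) K) - (u : Matrix (Fin 1) (Fin 1) K) 0 0 • (1 : Matrix (Fin 3) (Fin 3) K)) *ᵥ x ∈ M := by
  have hΓx : ((endoGL (γ₂, u) : GL (Fin 3) K) : Matrix (Fin 3) (Fin 3) K) *ᵥ x ∈ M := by
    have h := hfix (Submodule.mem_map_of_mem (f := (Matrix.toLin' ((endoGL (γ₂, u) : GL (Fin 3) K) : Matrix (Fin 3) (Fin 3) K)).restrictScalars 𝒪[K]) hx)
    rwa [LinearMap.restrictScalars_apply, Matrix.toLin'_apply] at h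
  rw [Matrix.sub_mulVec, Matrix.smul_mulVec, Matrix.one_mulVec]
  exact M.sub_mem hΓx (smul_mem_of_v_le M hu hx)

omit [Valued K ℤᵐ⁰] in
/-- **CAYLEY–HAMILTON FOR THE `W`-BLOCK OF `S = Γ − u₀₀·1`**: `det T₂ · pr_W x = tr T₂ · Sx − S(Sx)` with `T₂ = γ₂ − u₀₀·1` (`S` kills `e₁` and acts on `W` by `T₂`,
`T₂² − tr T₂·T₂ + det T₂ = 0`). [cite: Rogawski1990, §4.8 Case (a) p. 53] [cite: BruhatTits1972, §10] -/
theorem det_sub_smul_one_smul_sub_single_eq (γ₂ : GL (Fin 2) K) (u : GL (Fin 1) K) (x : Fin 3 → K) :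
    ((γ₂ : Matrix (Fin 2) (Fin 2) K) - (u : Matrix (Fin 1) (Fin 1) K) 0 0 • (1 : Matrix (Fin 2) (Fin 2) K)).det • (x - Pi.single 1 (x 1)) =
      ((γ₂ : Matrix (Fin 2) (Fin 2) K) - (u : Matrix (Fin 1) (Fin 1) K) 0 0 • (1 : Matrix (Fin 2) (Fin 2) K)).trace •
          ((((endoGL (γ₂, u) : GL (Fin 3) K) : Matrix (Fin 3) (Fin 3) K) - (u : Matrix (Fin 1) (Fin 1) K) 0 0 • (1 : Matrix (Fin 3) (Fin 3) K)) *ᵥ x) -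
        (((endoGL (γ₂, u) : GL (Fin 3) K) : Matrix (Fin 3) (Fin 3) K) - (u : Matrix (Fin 1) (Fin 1) K) 0 0 • (1 : Matrix (Fin 3) (Fin 3) K)) *ᵥ
          ((((endoGL (γ₂, u) : GL (Fin 3) K) : Matrix (Fin 3) (Fin 3) K) - (u : Matrix (Fin 1) (Fin 1) K) 0 0 • (1 : Matrix (Fin 3) (Fin 3) K)) *ᵥ x) := by
  rw [coe_endoGL_eq_endoShape]
  ext i
  fin_cases i <;>
    simp [-Matrix.mulVec_mulVec, Matrix.mulVec, dotProduct, Fin.sum_univ_three, Matrix.det_fin_two, Matrix.trace_fin_two, Matrix.one_apply] <;> ring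

/-- `|u₀₀| ≤ 1` when `Γ·M ≤ M` and `M` has a tube coordinate (`Γ(ϖ^b e₁) = u₀₀ϖ^b·e₁ ∈ M`). [cite: Kottwitz1986, §3] [cite: BruhatTits1972, §10] -/
theorem v_coe_one_le_one_of_tubeCoordinate {ϖ : K} (hϖ : Valued.v ϖ = WithZero.exp (-1 : ℤ)) {M : Submodule 𝒪[K] (Fin 3 → K)}
    (γ₂ : GL (Fin 2) K) (u : GL (Fin 1) K) (hfix : mapGL (endoGL (γ₂, u)) M ≤ M)
    {b : ℕ} (hb : ∀ c : K, (Pi.single 1 c : Fin 3 → K) ∈ M ↔ Valued.v c ≤ Valued.v ϖ ^ b) :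
    Valued.v ((u : Matrix (Fin 1) (Fin 1) K) 0 0) ≤ 1 := by
  have hϖ0 : Valued.v ϖ ≠ 0 := by rw [hϖ]; exact WithZero.exp_ne_zero
  have he : (Pi.single 1 (ϖ ^ b) : Fin 3 → K) ∈ M := (hb _).2 (by rw [map_pow])
  have hΓe : ((endoGL (γ₂, u) : GL (Fin 3) K) : Matrix (Fin 3) (Fin 3) K) *ᵥ Pi.single 1 (ϖ ^ b) ∈ M := by
    have h := hfix (Submodule.mem_map_of_mem (f := (Matrix.toLin' ((endoGL (γ₂, u) : GL (Fin 3) K) : Matrix (Fin 3) (Fin 3) K)).restrictScalars 𝒪[K]) he)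
    rwa [LinearMap.restrictScalars_apply, Matrix.toLin'_apply] at h
  rw [endoGL_mulVec_single_one, hb, map_mul, map_pow] at hΓe
  exact le_one_of_mul_le_self (pow_ne_zero _ hϖ0) hΓe

/-- **`det T₂ · pr_W x ∈ M`** for `x ∈ M`, when `Γ·M ≤ M`, `|u₀₀| ≤ 1` and `|tr T₂| ≤ 1` (Cayley–Hamilton + `S·M ≤ M`). [cite: Kottwitz1986, §3] [cite: BruhatTits1972, §10] -/
theorem det_sub_smul_one_smul_sub_single_mem {M : Submodule 𝒪[K] (Fin 3 → K)} (γ₂ : GL (Fin 2) K) (u : GL (Fin 1) K)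
    (hu : Valued.v ((u : Matrix (Fin 1) (Fin 1) K) 0 0) ≤ 1)
    (htr : Valued.v ((γ₂ : Matrix (Fin 2) (Fin 2) K) - (u : Matrix (Fin 1) (Fin 1) K) 0 0 • (1 : Matrix (Fin 2) (Fin 2) K)).trace ≤ 1)
    (hfix : mapGL (endoGL (γ₂, u)) M ≤ M) {x : Fin 3 → K} (hx : x ∈ M) :
    ((γ₂ : Matrix (Fin 2) (Fin 2) K) - (u : Matrix (Fin 1) (Fin 1) K) 0 0 • (1 : Matrix (Fin 2) (Fin 2) K)).det • (x - Pi.single 1 (x 1)) ∈ M := by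
  rw [det_sub_smul_one_smul_sub_single_eq]
  have h1 := endoGL_sub_smul_one_mulVec_mem γ₂ u hu hfix hx
  exact M.sub_mem (smul_mem_of_v_le M htr h1) (endoGL_sub_smul_one_mulVec_mem γ₂ u hu hfix h1)

/-- **THE TUBE BOUND.**  For a SELF-DUAL `M` (block form) with `Γ·M ≤ M`, `|tr(γ₂ − u₀₀·1)| ≤ 1` and tube coordinate `b ≥ 1`: **`|det(γ₂ − u₀₀·1)| ≤ |ϖ|^{2b}`** — the glue
module `pr_W M ∕ (M ∩ W)` is cyclic of length `2b` generated by `pr_W x₀` (★ (c1-ii′)), and `det T₂ · pr_W x₀ ∈ M`.  So `b ≤ v(χ_{γ₂}(u₀₀))∕2`.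
[cite: Kottwitz1986, §3] [cite: BruhatTits1972, §10] [cite: Serre1980Trees, II.1.3] -/
theorem v_det_sub_smul_one_le_of_tubeCoordinate (σ : K →+* K) (hvσ : ∀ a, Valued.v (σ a) = Valued.v a) {ϖ : K} (hϖ : Valued.v ϖ = WithZero.exp (-1 : ℤ))
    {H₂ : Matrix (Fin 2) (Fin 2) K} (hH₂ : IsUnit H₂.det) {h : K} (hh : Valued.v h = 1)
    {M : Submodule 𝒪[K] (Fin 3 → K)} (hM : IsSelfDualLattice σ ϖ (!![H₂ 0 0, 0, H₂ 0 1; 0, h, 0; H₂ 1 0, 0, H₂ 1 1] : Matrix (Fin 3) (Fin 3) K) M)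
    (γ₂ : GL (Fin 2) K) (u : GL (Fin 1) K)
    (htr : Valued.v ((γ₂ : Matrix (Fin 2) (Fin 2) K) - (u : Matrix (Fin 1) (Fin 1) K) 0 0 • (1 : Matrix (Fin 2) (Fin 2) K)).trace ≤ 1)
    (hfix : mapGL (endoGL (γ₂, u)) M ≤ M) {b : ℕ} (hb1 : 1 ≤ b) (hb : ∀ c : K, (Pi.single 1 c : Fin 3 → K) ∈ M ↔ Valued.v c ≤ Valued.v ϖ ^ b) :
    Valued.v ((γ₂ : Matrix (Fin 2) (Fin 2) K) - (u : Matrix (Fin 1) (Fin 1) K) 0 0 • (1 : Matrix (Fin 2) (Fin 2) K)).det ≤ Valued.v ϖ ^ (2 * b) := by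
  obtain ⟨b', hb', hpr, x₀, hx₀, hx₀1⟩ := exists_tubeCoordinate σ hvσ hϖ hH₂ hh hM
  obtain ⟨rfl, -⟩ := tubeCoordinate_unique hϖ hb hb'
  have hu := v_coe_one_le_one_of_tubeCoordinate hϖ γ₂ u hfix hb
  exact ((exists_smul_add_of_tubeCoordinate σ hvσ hϖ hh hM hb1 hb hpr hx₀ hx₀1).2 _).1 (det_sub_smul_one_smul_sub_single_mem γ₂ u hu htr hfix hx₀)

/-- **`b ≤ R` FROM THE TUBE BOUND**: if `|det(γ₂ − u₀₀·1)| = exp(n)` then every tube coordinate `b` of a self-dual `M` with `Γ·M ≤ M` satisfies `b ≤ (−n).toNat` (so `R := v(χ_{γ₂}(u₀₀))`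
is a tube bound in the sense of ★ THM A). [cite: Kottwitz1986, §3] [cite: BruhatTits1972, §10] -/
theorem tubeCoordinate_le_of_v_det_eq (σ : K →+* K) (hvσ : ∀ a, Valued.v (σ a) = Valued.v a) {ϖ : K} (hϖ : Valued.v ϖ = WithZero.exp (-1 : ℤ))
    {H₂ : Matrix (Fin 2) (Fin 2) K} (hH₂ : IsUnit H₂.det) {h : K} (hh : Valued.v h = 1)
    {M : Submodule 𝒪[K] (Fin 3 → K)} (hM : IsSelfDualLattice σ ϖ (!![H₂ 0 0, 0, H₂ 0 1; 0, h, 0; H₂ 1 0, 0, H₂ 1 1] : Matrix (Fin 3) (Fin 3) K) M)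
    (γ₂ : GL (Fin 2) K) (u : GL (Fin 1) K)
    (htr : Valued.v ((γ₂ : Matrix (Fin 2) (Fin 2) K) - (u : Matrix (Fin 1) (Fin 1) K) 0 0 • (1 : Matrix (Fin 2) (Fin 2) K)).trace ≤ 1)
    {n : ℤ} (hn : Valued.v ((γ₂ : Matrix (Fin 2) (Fin 2) K) - (u : Matrix (Fin 1) (Fin 1) K) 0 0 • (1 : Matrix (Fin 2) (Fin 2) K)).det = WithZero.exp n)
    (hfix : mapGL (endoGL (γ₂, u)) M ≤ M) {b : ℕ} (hb : ∀ c : K, (Pi.single 1 c : Fin 3 → K) ∈ M ↔ Valued.v c ≤ Valued.v ϖ ^ b) :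
    b ≤ (-n).toNat := by
  rcases Nat.eq_zero_or_pos b with rfl | hb1
  · exact Nat.zero_le _
  have hle := v_det_sub_smul_one_le_of_tubeCoordinate σ hvσ hϖ hH₂ hh hM γ₂ u htr hfix hb1 hb
  rw [hn, v_pow_eq_exp_neg hϖ, WithZero.exp_le_exp] at hle
  have h0 : ((-n).toNat : ℤ) = -n := Int.toNat_of_nonneg (by omega)
  omega

/-! ## §2 THM A′∕B′: the sockets `R`, `htube` of ★ THM A∕B discharged by `det(γ₂ − u₀₀·1) ≠ 0` -/

set_option maxHeartbeats 800000 in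
-- budget only: statement-heavy block tokens.
/-- **THM A′ — THE `Γ`-FIXED SELF-DUAL LATTICES OF A BLOCK ELEMENT ARE FINITELY MANY** when `χ_{γ₂}(u₀₀) = det(γ₂ − u₀₀·1) ≠ 0` and `|tr(γ₂ − u₀₀·1)| ≤ 1`, given finitely many
`γ₂`-fixed self-dual `W`-lattices: ★ THM A with the tube bound `R := v(χ_{γ₂}(u₀₀))` (§1). [cite: Kottwitz1986, §3] [cite: BruhatTits1972, §10] [cite: Serre1980Trees, II.1.3] -/
theorem finite_setOf_selfDual_mapGL_endoGL_eq_of_det_ne_zero [IsPrincipalIdealRing 𝒪[K]] [Finite 𝓀[K]] (σ : K →+* K) (hσ : ∀ a, σ (σ a) = a)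
    (hvσ : ∀ a, Valued.v (σ a) = Valued.v a) {ϖ : K} (hϖ : Valued.v ϖ = WithZero.exp (-1 : ℤ))
    {H₂ : Matrix (Fin 2) (Fin 2) K} (hH₂ : IsUnit H₂.det) (hH₂σ : (H₂.map σ)ᵀ = H₂) {h : K} (hh : Valued.v h = 1) (hhσ : σ h = h)
    (γ₂ : GL (Fin 2) K) (u : GL (Fin 1) K)
    (htr : Valued.v ((γ₂ : Matrix (Fin 2) (Fin 2) K) - (u : Matrix (Fin 1) (Fin 1) K) 0 0 • (1 : Matrix (Fin 2) (Fin 2) K)).trace ≤ 1)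
    (hΔ : ((γ₂ : Matrix (Fin 2) (Fin 2) K) - (u : Matrix (Fin 1) (Fin 1) K) 0 0 • (1 : Matrix (Fin 2) (Fin 2) K)).det ≠ 0)
    (hWfin : {B : Submodule 𝒪[K] (Fin 2 → K) | IsSelfDualLattice σ ϖ H₂ B ∧ mapGL γ₂ B = B}.Finite) :
    {M : Submodule 𝒪[K] (Fin 3 → K) | IsSelfDualLattice σ ϖ (!![H₂ 0 0, 0, H₂ 0 1; 0, h, 0; H₂ 1 0, 0, H₂ 1 1] : Matrix (Fin 3) (Fin 3) K) M ∧
      mapGL (endoGL (γ₂, u)) M = M}.Finite := by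
  have hvΔ : Valued.v ((γ₂ : Matrix (Fin 2) (Fin 2) K) - (u : Matrix (Fin 1) (Fin 1) K) 0 0 • (1 : Matrix (Fin 2) (Fin 2) K)).det ≠ 0 := (Valuation.ne_zero_iff _).2 hΔ
  have hn := (WithZero.exp_log hvΔ).symm
  exact finite_setOf_selfDual_mapGL_endoGL_eq σ hσ hvσ hϖ hH₂ hH₂σ hh hhσ γ₂ u hWfin _ fun M hM hfix b hb =>
    tubeCoordinate_le_of_v_det_eq σ hvσ hϖ hH₂ hh hM γ₂ u htr hn hfix.le hb

set_option maxHeartbeats 800000 in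
-- budget only: statement-heavy block tokens.
/-- **THM B′ — (z6) «FIX-FINITE, BLOCK LITERAL» with the tube bound discharged**: for `H = ι-shape(H₂, h)`, `γ ∈ U(σ, H)` with matrix `ι(γ₂, u)`, `det(γ₂ − u₀₀·1) ≠ 0` and
`|tr(γ₂ − u₀₀·1)| ≤ 1`, the fixed vertex set `{v ∣ γ·v = v}` is FINITE, given the tree, alternation and local finiteness of the graph and finitely many `γ₂`-fixed self-dual
`W`-lattices. [cite: Kottwitz1986, §3] [cite: BruhatTits1972, §10] [cite: Serre1980Trees, I.6.4, II.1.3] -/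
theorem finite_setOf_latticeGraphIso_endoGL_eq_of_det_ne_zero [IsPrincipalIdealRing 𝒪[K]] [Finite 𝓀[K]] (σ : K →+* K) (hσ : ∀ a, σ (σ a) = a)
    (hvσ : ∀ a, Valued.v (σ a) = Valued.v a) {ϖ : K} (hϖ : Valued.v ϖ = WithZero.exp (-1 : ℤ))
    {H₂ : Matrix (Fin 2) (Fin 2) K} (hH₂ : IsUnit H₂.det) (hH₂σ : (H₂.map σ)ᵀ = H₂) {h : K} (hh : Valued.v h = 1) (hhσ : σ h = h)
    {H : Matrix (Fin 3) (Fin 3) K} (hH : H = !![H₂ 0 0, 0, H₂ 0 1; 0, h, 0; H₂ 1 0, 0, H₂ 1 1])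
    (hT : (latticeGraph σ ϖ H).IsTree)
    (halt : ∀ v w, (latticeGraph σ ϖ H).Adj v w → (IsSelfDualLattice σ ϖ H v.1 ↔ ¬ IsSelfDualLattice σ ϖ H w.1))
    (hloc : ∀ v, ((latticeGraph σ ϖ H).neighborSet v).Finite)
    (γ : unitaryGroupOfForm σ H) (γ₂ : GL (Fin 2) K) (u : GL (Fin 1) K) (hγ : (γ : GL (Fin 3) K) = endoGL (γ₂, u))
    (htr : Valued.v ((γ₂ : Matrix (Fin 2) (Fin 2) K) - (u : Matrix (Fin 1) (Fin 1) K) 0 0 • (1 : Matrix (Fin 2) (Fin 2) K)).trace ≤ 1)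
    (hΔ : ((γ₂ : Matrix (Fin 2) (Fin 2) K) - (u : Matrix (Fin 1) (Fin 1) K) 0 0 • (1 : Matrix (Fin 2) (Fin 2) K)).det ≠ 0)
    (hWfin : {B : Submodule 𝒪[K] (Fin 2 → K) | IsSelfDualLattice σ ϖ H₂ B ∧ mapGL γ₂ B = B}.Finite) :
    {v : {M : Submodule 𝒪[K] (Fin 3 → K) // IsVertex σ ϖ H M} | latticeGraphIso σ ϖ H γ v = v}.Finite := by
  have hvΔ : Valued.v ((γ₂ : Matrix (Fin 2) (Fin 2) K) - (u : Matrix (Fin 1) (Fin 1) K) 0 0 • (1 : Matrix (Fin 2) (Fin 2) K)).det ≠ 0 := (Valuation.ne_zero_iff _).2 hΔ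
  have hn := (WithZero.exp_log hvΔ).symm
  exact finite_setOf_latticeGraphIso_endoGL_eq σ hσ hvσ hϖ hH₂ hH₂σ hh hhσ hH hT halt hloc γ γ₂ u hγ hWfin _ fun M hM hfix b hb =>
    tubeCoordinate_le_of_v_det_eq σ hvσ hϖ hH₂ hh hM γ₂ u htr hn hfix.le hb

/-! ## §3 The J₀ dress: `H = Φ₃ = antidiag(1, 1, 1) = ι-shape(Φ₂, 1)` under the tame-ramified hypotheses of `strataCount_J₀_block` -/

omit [Valued K ℤᵐ⁰] in
/-- `Φ₃ = ι-shape(Φ₂, 1)` with `Φ₂ = !![0, 1; 1, 0]`. [cite: Rogawski1990, §4.8 Case (a) p. 53] -/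
theorem antidiagonal_three_over_eq_endoShape :
    (StdForm.antidiagonal 3).over K =
      !![(!![(0 : K), 1; 1, 0] : Matrix (Fin 2) (Fin 2) K) 0 0, 0, (!![(0 : K), 1; 1, 0] : Matrix (Fin 2) (Fin 2) K) 0 1; 0, (1 : K), 0;
        (!![(0 : K), 1; 1, 0] : Matrix (Fin 2) (Fin 2) K) 1 0, 0, (!![(0 : K), 1; 1, 0] : Matrix (Fin 2) (Fin 2) K) 1 1] := by
  ext i j
  fin_cases i <;> fin_cases j <;> simp [StdForm.over, Fin.rev]

omit [Valued K ℤᵐ⁰] in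
/-- `χ_A(c) = det(A − c·1)` for a `2 × 2` matrix. [cite: Rogawski1990, §4.9 p. 54] -/
theorem eval_charpoly_fin_two_eq_det_sub_smul_one (A : Matrix (Fin 2) (Fin 2) K) (c : K) :
    A.charpoly.eval c = (A - c • (1 : Matrix (Fin 2) (Fin 2) K)).det := by
  rw [Matrix.eval_charpoly, Matrix.det_fin_two, Matrix.det_fin_two]
  simp [Matrix.scalar_apply]
  ring

set_option maxHeartbeats 800000 in
-- budget only: statement-heavy lattice tokens.
/-- **THE J₀ DRESS OF (z6) — the `hFfin` binder of `strataCount_J₀_block` at a type-(2) literal.**  Under the tame-ramified hypotheses `(hσ hvσ hσϖ hϖ hres h2 hnorm)` (so the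
lattice graph of `Φ₃` is a locally finite tree with alternating vertex types, ★), for `γ ∈ K₀ = unitaryInt` with matrix `ι(γ₂, u)` and `χ_{γ₂}(u₀₀) = det(γ₂ − u₀₀·1) ≠ 0`, the
fixed vertex set `{v ∣ γ·v = v}` is FINITE, given finitely many `γ₂`-fixed self-dual lattices of `(K², Φ₂)` (`hWfin`; at the CM place ★ `finite_selfDual_fixed_of_{even,odd}_depth_ramified`
after `rw [placeForm_antidiagOne, stdForm_antidiagonal_two_over_eq]`). [cite: Kottwitz1986, §3] [cite: BruhatTits1972, §10] [cite: Rogawski1990, §4.9 pp. 54–56] -/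
theorem finite_setOf_latticeGraphIso_antidiagonal_three_eq_of_coe_eq_endoGL [ValuativeRel K] [(Valued.v : Valuation K ℤᵐ⁰).Compatible]
    [IsPrincipalIdealRing 𝒪[K]] [Finite 𝓀[K]] {σ : K →+* K} {ϖ : K}
    (hσ : ∀ x, σ (σ x) = x) (hvσ : ∀ a, Valued.v (σ a) = Valued.v a) (hσϖ : σ ϖ = -ϖ)
    (hϖ : Valued.v ϖ = WithZero.exp (-1 : ℤ)) (hres : ∀ x : K, Valued.v x ≤ 1 → Valued.v (σ x - x) < 1) (h2 : Valued.v (2 : K) = 1)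
    (hnorm : ∀ u : K, σ u = u → Valued.v (u - 1) < 1 → ∃ z : K, z * σ z = u ∧ Valued.v (z - 1) ≤ Valued.v (u - 1))
    (γ : unitaryGroupOfForm σ ((StdForm.antidiagonal 3).over K)) (hγ0 : γ ∈ unitaryInt σ ((StdForm.antidiagonal 3).over K))
    (γ₂ : GL (Fin 2) K) (u : GL (Fin 1) K) (hγ : (γ : GL (Fin 3) K) = endoGL (γ₂, u))
    (hΔ : ((γ₂ : Matrix (Fin 2) (Fin 2) K) - (u : Matrix (Fin 1) (Fin 1) K) 0 0 • (1 : Matrix (Fin 2) (Fin 2) K)).det ≠ 0)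
    (hWfin : {B : Submodule 𝒪[K] (Fin 2 → K) | IsSelfDualLattice σ ϖ (!![(0 : K), 1; 1, 0] : Matrix (Fin 2) (Fin 2) K) B ∧ mapGL γ₂ B = B}.Finite) :
    {v : {M : Submodule 𝒪[K] (Fin 3 → K) // IsVertex σ ϖ ((StdForm.antidiagonal 3).over K) M} |
      latticeGraphIso σ ϖ ((StdForm.antidiagonal 3).over K) γ v = v}.Finite := by
  have hH₂ : IsUnit (!![(0 : K), 1; 1, 0] : Matrix (Fin 2) (Fin 2) K).det := by
    rw [Matrix.det_fin_two]; simp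
  have hH₂σ : ((!![(0 : K), 1; 1, 0] : Matrix (Fin 2) (Fin 2) K).map σ)ᵀ = !![(0 : K), 1; 1, 0] := by
    ext i j; fin_cases i <;> fin_cases j <;> simp
  -- `|tr(γ₂ − u₀₀·1)| ≤ 1` from `γ ∈ K₀`
  have hint : IsIntMatrix (((γ : GL (Fin 3) K)) : Matrix (Fin 3) (Fin 3) K) := (HermitianLattice.mem_unitaryInt_iff.1 hγ0).1
  rw [hγ] at hint
  obtain ⟨hγ₂, hu⟩ := (isIntMatrix_coe_endoGL_iff γ₂ u).1 hint
  have htr : Valued.v ((γ₂ : Matrix (Fin 2) (Fin 2) K) - (u : Matrix (Fin 1) (Fin 1) K) 0 0 • (1 : Matrix (Fin 2) (Fin 2) K)).trace ≤ 1 := by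
    rw [Matrix.trace_sub, Matrix.trace_smul, Matrix.trace_one, Matrix.trace_fin_two, smul_eq_mul]
    refine Valuation.map_sub_le _ (Valuation.map_add_le _ (hγ₂ 0 0) (hγ₂ 1 1)) ?_
    rw [map_mul]
    refine mul_le_one' hu ?_
    have h21 : ((Fintype.card (Fin 2) : ℕ) : K) = 2 := by rw [Fintype.card_fin]; norm_num
    rw [h21, h2]
  exact finite_setOf_latticeGraphIso_endoGL_eq_of_det_ne_zero σ hσ hvσ hϖ hH₂ hH₂σ (h := 1) (by rw [map_one]) (map_one σ)
    antidiagonal_three_over_eq_endoShape (isTree_latticeGraph_three_of_neg hσ hvσ hϖ hσϖ hres h2 hnorm)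
    (fun _ _ hadj => isSelfDualLattice_iff_not_isSelfDualLattice_of_adj_of_v hvσ hϖ hadj)
    (finite_neighborSet_of_ramified hσ hvσ hσϖ hϖ hres h2 hnorm) γ γ₂ u hγ htr hΔ hWfin

set_option maxHeartbeats 800000 in
-- budget only: statement-heavy lattice tokens.
/-- **THE J₀ DRESS OF (z6), `hirr` CURRENCY**: as `finite_setOf_latticeGraphIso_antidiagonal_three_eq_of_coe_eq_endoGL`, with `det(γ₂ − u₀₀·1) ≠ 0` replaced by «`u₀₀` is not a
root of `χ_{γ₂}`» (at the CM place `χ_{γ₂}` has no root in `K` at all). [cite: Kottwitz1986, §3] [cite: Rogawski1990, §4.9 pp. 54–56] -/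
theorem finite_setOf_latticeGraphIso_antidiagonal_three_eq_of_not_isRoot_charpoly [ValuativeRel K] [(Valued.v : Valuation K ℤᵐ⁰).Compatible]
    [IsPrincipalIdealRing 𝒪[K]] [Finite 𝓀[K]] {σ : K →+* K} {ϖ : K}
    (hσ : ∀ x, σ (σ x) = x) (hvσ : ∀ a, Valued.v (σ a) = Valued.v a) (hσϖ : σ ϖ = -ϖ)
    (hϖ : Valued.v ϖ = WithZero.exp (-1 : ℤ)) (hres : ∀ x : K, Valued.v x ≤ 1 → Valued.v (σ x - x) < 1) (h2 : Valued.v (2 : K) = 1)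
    (hnorm : ∀ u : K, σ u = u → Valued.v (u - 1) < 1 → ∃ z : K, z * σ z = u ∧ Valued.v (z - 1) ≤ Valued.v (u - 1))
    (γ : unitaryGroupOfForm σ ((StdForm.antidiagonal 3).over K)) (hγ0 : γ ∈ unitaryInt σ ((StdForm.antidiagonal 3).over K))
    (γ₂ : GL (Fin 2) K) (u : GL (Fin 1) K) (hγ : (γ : GL (Fin 3) K) = endoGL (γ₂, u))
    (hirr : ¬ (γ₂ : Matrix (Fin 2) (Fin 2) K).charpoly.IsRoot ((u : Matrix (Fin 1) (Fin 1) K) 0 0))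
    (hWfin : {B : Submodule 𝒪[K] (Fin 2 → K) | IsSelfDualLattice σ ϖ (!![(0 : K), 1; 1, 0] : Matrix (Fin 2) (Fin 2) K) B ∧ mapGL γ₂ B = B}.Finite) :
    {v : {M : Submodule 𝒪[K] (Fin 3 → K) // IsVertex σ ϖ ((StdForm.antidiagonal 3).over K) M} |
      latticeGraphIso σ ϖ ((StdForm.antidiagonal 3).over K) γ v = v}.Finite := by
  refine finite_setOf_latticeGraphIso_antidiagonal_three_eq_of_coe_eq_endoGL hσ hvσ hσϖ hϖ hres h2 hnorm γ hγ0 γ₂ u hγ ?_ hWfin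
  rw [← eval_charpoly_fin_two_eq_det_sub_smul_one]
  exact hirr

end Literature.NumberTheory.Automorphic.UnitaryLatticeTree

end
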